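import Summits.ABC.IUTFork.LDHPerPrimeReadingWitness
import Literature.IUT.LogVolume.GenuineLogThetaSplitBadPrimes
import HarnessLib

/-!
# The fork at [IUTchIII] Corollary 3.12, L-DH level: the CLAIM-form `Cor312Of` HOLDS at EVERY depth for a synthetic
# genuine-completion input whose one bad place carries at most a third of the degree

Record-only file (D-0012) of the abc-iut cell (Cor. 3.12 crew, L-DH lane, seat abc-iut-c312-3; item «XXVIIc-DH»);
TAKES NO SIDE on [IUTchIII] Cor. 3.12. The mirror image of abc-iut-w5-d157's `LDHSyntheticCor312Failure`
(`ThetaVolumeInput.exists_deepAt_not_cor312Of`: over a degree-one base, ONE deep bad prime with `S = V(F₀)_p` ⇒ `Cor312Of`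
FALSE for large depth `N`). Here the same synthetic recipe (`j_E := p^{−2lN}`, ideles := powers of `p` in the GENUINE
completions `K_{v̲}`, abc-iut-w5-d157's `LocalFields.primeUnit'`) is run with the bad set a SINGLE chosen place `S := {v₀}`,
`v₀ | p` ([IUTchI] Def. 3.1 (b)/(e): `𝕍^bad_mod` is a CHOSEN non-empty set of places of bad multiplicative reduction):

* `PilotData.deepAtPlace`, `ThetaVolumeInput.deepAtPlace` — the synthetic pilot data / input;
* `deepAtPlace_badMass_le` — its bad mass at every prime is `≤ Pr(v₀) = n_{v₀}/[F₀:ℚ]`;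
* **`cor312Of_deepAtPlace`** — if `3·n_{v₀} ≤ [F₀:ℚ]` then, for EVERY depth `N`, EVERY `l`, EVERY `K ⊇ F₀` and section `σ`,
  `Cor312NonarchOf` AND `Cor312Of` HOLD for `deepAtPlace` (by `ThetaVolumeInput.cor312Of_of_badMass_le_third`, abc-iut-c312-3
  `GenuineLogThetaSplitBadPrimes`): the depth that refutes the typed inequality over `ℚ` is harmless over a base in which
  the bad place carries at most a third of the degree.

So the cell's sharp Dupuy–Hilado-level fork at genuine-completion inputs reads, kernel-checked on both sides:
«`[F₀:ℚ] = 1`, deep ⇒ FALSE (w5-d157); `3·n_{v₀} ≤ [F₀:ℚ]`, any depth ⇒ TRUE (this file)» — place combinatorics, orthogonal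
to the dispute. The arithmetic hypothesis `3·n_{v₀} ≤ [F₀:ℚ]` (a place of relative local degree `≤ 1/3`, e.g. an unramified
degree-one place of any field of degree `≥ 3`) is NOT instantiated on a concrete number field here.
HONEST SCOPE: SYNTHETIC inhabitant of the input type (not the Θ-volume input of initial Θ-data: there `K = F(E_F[l])` and the
ideles are `2l`-th roots of Tate parameters); a theorem about OUR typed objects ((Ind1) = all capsule-index permutations,
HOME/plan/c312/STEPV-IND1-NOTE.md ruling R2); nothing here bears on whether [IUTchIII] Thm. 3.11 licenses (1.1).
[cite: DupuyHilado2025, §1 (1.1), §3.3, §3.6, §3.9] [cite: Mochizuki2012, IUTchI Def. 3.1 (b)(e) p. 61–62]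
[cite: Mochizuki2012, IUTchIII Cor. 3.12 p. 173–174] [claim: Mochizuki2012, status: disputed] for every IUT quotation.
-/

noncomputable section

open Set NumberField IsDedekindDomain Literature.IUT.LogVolume

namespace Summit.ABC.IUTFork

section Witness

variable (F₀ : Type) [Field F₀] [NumberField F₀] {K : Type} [Field K] [NumberField K] [Algebra F₀ K]

/-- **Synthetic pilot data deep at ONE chosen place**: `j_E := (p^{2lN})⁻¹`, `S := {v₀}` for a place `v₀ | p`, the prime
`l ≥ 5`; so `ord_{v₀}(q_{v₀}) = 2lN·e_{v₀}`. An inhabitant of c312-3's `PilotData` chosen for its valuations (w5-d157's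
`deepAt` with the bad set shrunk to a singleton) — NOT claimed to come from a specific elliptic curve.
[cite: DupuyHilado2025, §3.2–3.3] [cite: Mochizuki2012, IUTchI Def. 3.1 (b) p. 61] -/
def PilotData.deepAtPlace (p : ℕ) [Fact p.Prime] (v₀ : placesOver F₀ p) (l : ℕ) (hl : l.Prime) (h5 : 5 ≤ l)
    (N : ℕ) (hN : 0 < N) : PilotData F₀ where
  jE := ((p : F₀) ^ (2 * l * N))⁻¹
  S := {v₀.1}
  S_nonempty := Finset.singleton_nonempty _
  ord_jE_neg := fun v hv => by
    rw [Finset.mem_singleton] at hv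
    subst hv
    rw [ord_inv, ord_pow, Cor22.ord_natCast_eq_ramIdx p v₀.1 v₀.2]
    have h1 : (0 : ℤ) < ramIdx F₀ v₀.1 := by exact_mod_cast Nat.pos_of_ne_zero (ramIdx_ne_zero F₀ v₀.1)
    have h2 : (0 : ℤ) < (2 * l * N : ℕ) := by exact_mod_cast (by positivity : 0 < 2 * l * N)
    nlinarith
  l := l
  l_prime := hl
  five_le_l := h5

variable {F₀}
variable (p : ℕ) [hp : Fact p.Prime] (v₀ : placesOver F₀ p) (l : ℕ) (hl : l.Prime) (h5 : 5 ≤ l) (N : ℕ) (hN : 0 < N)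

/-- Its bad set is `{v₀}`. [cite: DupuyHilado2025, §3.3] -/
theorem PilotData.deepAtPlace_S : (PilotData.deepAtPlace F₀ p v₀ l hl h5 N hN).S = {v₀.1} := rfl

/-- `ord_{v₀}(q_{v₀}) = 2lN·e_{v₀}` for the synthetic pilot data. [cite: DupuyHilado2025, §3.3] -/
theorem PilotData.deepAtPlace_ordq :
    (PilotData.deepAtPlace F₀ p v₀ l hl h5 N hN).ordq v₀.1 = 2 * l * N * ramIdx F₀ v₀.1 := by
  show -ord F₀ v₀.1 (((p : F₀) ^ (2 * l * N))⁻¹) = _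
  rw [ord_inv, ord_pow, Cor22.ord_natCast_eq_ramIdx p v₀.1 v₀.2]
  push_cast
  ring

open scoped Classical in
/-- **A SYNTHETIC Θ-volume input deep at one chosen place** over any section `σ` of the places of `K / F₀`: the pilot data
`PilotData.deepAtPlace` with the ideles `t_{Θ,j,v₀} := p^{j²N}`, `t_{q,v₀} := p^N` in the GENUINE completion `K_{v̲₀}` (and `1`
at every other place) — they realise `P_Θ`, `P_q` because `ord_v(p) = e_v`. An inhabitant of the INPUT TYPE (abc-iut-S2's
`ThetaVolumeInput`) exhibited for non-vacuity; NOT claimed to be the input of a collection of initial Θ-data.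
[cite: DupuyHilado2025, §3.9] [cite: Mochizuki2012, IUTchI Def. 3.1 (b)(e) p. 61–62] -/
def ThetaVolumeInput.deepAtPlace (σ : PlaceSection F₀ K) : ThetaVolumeInput F₀ K where
  X := PilotData.deepAtPlace F₀ p v₀ l hl h5 N hN
  σ := σ
  tΘ p' hp' i v := (@LocalFields.primeUnit' F₀ _ _ p' ⟨hp'⟩ (σ.localFieldFamily p' hp') v) ^
    (if v.1 = v₀.1 then ((i : ℕ) + 1) ^ 2 * N else 0)
  tΘ_ord p' hp' i v := by
    haveI : Fact p'.Prime := ⟨hp'⟩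
    rw [LocalFields.ordv_primeUnit'_pow, PilotData.thetaPilot_apply']
    change (((if v.1 = v₀.1 then ((i : ℕ) + 1) ^ 2 * N else 0 : ℕ) : ℝ) * ramIdx F₀ v.1 =
      if v.1 ∈ ({v₀.1} : Finset _) then _ else 0)
    simp only [Finset.mem_singleton]
    split_ifs with hv
    · rw [hv, PilotData.deepAtPlace_ordq p v₀ l hl h5 N hN]
      change _ = (((i : ℕ) + 1 : ℝ) ^ 2) * ((2 * l * N * ramIdx F₀ v₀.1 : ℤ) : ℝ) / (2 * (l : ℕ))
      have hl0 : (l : ℝ) ≠ 0 := by exact_mod_cast hl.ne_zero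
      push_cast
      field_simp
    · simp
  tq p' hp' i v := (@LocalFields.primeUnit' F₀ _ _ p' ⟨hp'⟩ (σ.localFieldFamily p' hp') v) ^
    (if v.1 = v₀.1 then N else 0)
  tq_ord p' hp' i v := by
    haveI : Fact p'.Prime := ⟨hp'⟩
    rw [LocalFields.ordv_primeUnit'_pow, PilotData.qPilot_apply']
    change (((if v.1 = v₀.1 then N else 0 : ℕ) : ℝ) * ramIdx F₀ v.1 =
      if v.1 ∈ ({v₀.1} : Finset _) then _ else 0)
    simp only [Finset.mem_singleton]
    split_ifs with hv
    · rw [hv, PilotData.deepAtPlace_ordq p v₀ l hl h5 N hN]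
      change _ = ((2 * l * N * ramIdx F₀ v₀.1 : ℤ) : ℝ) / (2 * (l : ℕ))
      have hl0 : (l : ℝ) ≠ 0 := by exact_mod_cast hl.ne_zero
      push_cast
      field_simp
    · simp

/-- The synthetic input's bad set is `{v₀}`. [cite: DupuyHilado2025, §3.3] -/
theorem ThetaVolumeInput.deepAtPlace_S (σ : PlaceSection F₀ K) :
    (ThetaVolumeInput.deepAtPlace p v₀ l hl h5 N hN σ).X.S = {v₀.1} := rfl

/-- **The bad mass of the synthetic input at ANY prime is at most `Pr(v₀) = n_{v₀}/[F₀:ℚ]`** (the bad set is the single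
place `v₀`). [cite: DupuyHilado2025, §3.6] -/
theorem ThetaVolumeInput.deepAtPlace_badMass_le (σ : PlaceSection F₀ K) (p' : ℕ) :
    ∑ v : placesOver F₀ p',
        ((ThetaVolumeInput.deepAtPlace p v₀ l hl h5 N hN σ).X.S : Set (HeightOneSpectrum (𝓞 F₀))).indicator
          (weight F₀) v.1 ≤
      weight F₀ v₀.1 := by
  classical
  rw [ThetaVolumeInput.deepAtPlace_S, Finset.coe_singleton,
    Finset.sum_coe_sort (placesOver F₀ p') (fun w => ({v₀.1} : Set _).indicator (weight F₀) w)]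
  have h : ∀ w ∈ placesOver F₀ p', ({v₀.1} : Set (HeightOneSpectrum (𝓞 F₀))).indicator (weight F₀) w =
      if v₀.1 = w then weight F₀ v₀.1 else 0 := by
    intro w _
    by_cases hw : v₀.1 = w
    · rw [if_pos hw, ← hw]
      exact Set.indicator_of_mem (Set.mem_singleton _) _
    · rw [if_neg hw]
      exact Set.indicator_of_notMem (fun h => hw (Set.mem_singleton_iff.mp h).symm) _
  rw [Finset.sum_congr rfl h, Finset.sum_ite_eq]
  split_ifs
  · exact le_rfl
  · exact weight_nonneg F₀ v₀.1

/-- **`Cor312Of` HOLDS AT EVERY DEPTH for the synthetic input deep at a place of relative local degree `≤ 1/3`.** If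
`3·n_{v₀} ≤ [F₀:ℚ]` then for every depth `N`, every prime `l ≥ 5`, every `K ⊇ F₀` and section `σ`, Dupuy–Hilado's (1.1)
(`Cor312NonarchOf`) and [IUTchIII] Cor. 3.12 (`Cor312Of`) HOLD for `deepAtPlace p v₀ l N σ` — by abc-iut-c312-3's
`cor312Of_of_badMass_le_third` (bad mass `≤ Pr(v₀) ≤ 1/3` at every prime). The mirror of w5-d157's
`exists_deepAt_not_cor312Of` (`[F₀:ℚ] = 1`, large depth ⇒ FALSE). A statement about OUR typed objects at a SYNTHETIC input;
no side taken on print's Cor. 3.12. [claim: Mochizuki2012, status: disputed] [cite: DupuyHilado2025, §1 (1.1), §3.6] -/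
theorem ThetaVolumeInput.cor312Of_deepAtPlace (σ : PlaceSection F₀ K)
    (h3 : 3 * localDegree F₀ v₀.1 ≤ Module.finrank ℚ F₀) :
    (ThetaVolumeInput.deepAtPlace p v₀ l hl h5 N hN σ).Cor312NonarchOf ∧
      (ThetaVolumeInput.deepAtPlace p v₀ l hl h5 N hN σ).Cor312Of := by
  refine (ThetaVolumeInput.deepAtPlace p v₀ l hl h5 N hN σ).cor312Of_of_badMass_le_third fun p' _ => ?_
  refine (ThetaVolumeInput.deepAtPlace_badMass_le p v₀ l hl h5 N hN σ p').trans ?_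
  have hF : (0 : ℝ) < Module.finrank ℚ F₀ := by exact_mod_cast Module.finrank_pos
  have h3' : (3 : ℝ) * localDegree F₀ v₀.1 ≤ Module.finrank ℚ F₀ := by exact_mod_cast h3
  rw [weight, div_le_div_iff₀ hF (by norm_num : (0 : ℝ) < 3), one_mul]
  linarith

/-- **The synthetic input is genuinely DEEP**: its `q`-parameter divisor is `𝔮 = 2lN·e_{v₀}·[v₀]`, of normalised degree
`deĝ̲(𝔮) = 2lN·e_{v₀}·ln N(v₀)/[F₀:ℚ]` — linear in the depth `N`. [cite: DupuyHilado2025, §3.3] -/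
theorem ThetaVolumeInput.deepAtPlace_ndeg_qDivisor (σ : PlaceSection F₀ K) :
    FinDivisor.ndeg F₀ (ThetaVolumeInput.deepAtPlace p v₀ l hl h5 N hN σ).X.qDivisor =
      (2 * l * N * ramIdx F₀ v₀.1 : ℕ) * logNorm F₀ v₀.1 / Module.finrank ℚ F₀ := by
  show FinDivisor.ndeg F₀ (∑ v ∈ ({v₀.1} : Finset _),
    FinDivisor.of v ((PilotData.deepAtPlace F₀ p v₀ l hl h5 N hN).ordq v : ℝ)) = _
  rw [Finset.sum_singleton, PilotData.deepAtPlace_ordq, FinDivisor.ndeg_of]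
  push_cast
  ring

/-- … so the depth is UNBOUNDED along the family: for every bound `B` some `N` has `deĝ̲(𝔮) > B` — in particular the
family leaves the SHALLOW regime of skeleton XXVIIc (`ForkGenuineRegimes.cor312Of_of_shallow`, `κ_l·deĝ̲(𝔮) ≤ ((l+5)/4)·log π`)
while, under `3·n_{v₀} ≤ [F₀:ℚ]`, `Cor312Of` keeps holding (`cor312Of_deepAtPlace`): the split regime is not a sub-case
of the shallow one. [cite: DupuyHilado2025, §3.3] -/
theorem ThetaVolumeInput.exists_deepAtPlace_ndeg_qDivisor_gt (σ : PlaceSection F₀ K) (B : ℝ) :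
    ∃ (N : ℕ) (hN : 0 < N),
      B < FinDivisor.ndeg F₀ (ThetaVolumeInput.deepAtPlace p v₀ l hl h5 N hN σ).X.qDivisor := by
  -- the slope `A = 2l·e_{v₀}·ln N(v₀)/[F₀:ℚ] > 0`
  set A : ℝ := (2 * l * ramIdx F₀ v₀.1 : ℕ) * logNorm F₀ v₀.1 / Module.finrank ℚ F₀ with hA
  have he : (0 : ℝ) < ramIdx F₀ v₀.1 := by exact_mod_cast Nat.pos_of_ne_zero (ramIdx_ne_zero F₀ v₀.1)
  have hl0 : (0 : ℝ) < l := by exact_mod_cast hl.pos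
  have hF : (0 : ℝ) < Module.finrank ℚ F₀ := by exact_mod_cast Module.finrank_pos
  have hApos : 0 < A := by
    have : (0 : ℝ) < (2 * l * ramIdx F₀ v₀.1 : ℕ) := by push_cast; positivity
    rw [hA]
    exact div_pos (mul_pos this (logNorm_pos F₀ v₀.1)) hF
  obtain ⟨N, hN⟩ := exists_nat_gt (B / A)
  refine ⟨N + 1, Nat.succ_pos N, ?_⟩
  rw [ThetaVolumeInput.deepAtPlace_ndeg_qDivisor]
  have hkey : ((2 * l * (N + 1) * ramIdx F₀ v₀.1 : ℕ) : ℝ) * logNorm F₀ v₀.1 / Module.finrank ℚ F₀ =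
      A * ((N : ℝ) + 1) := by
    rw [hA]; push_cast; ring
  rw [hkey]
  have hB : B < A * N := by rwa [div_lt_iff₀ hApos, mul_comm] at hN
  nlinarith

/-- For the synthetic input of ANY depth, Dupuy–Hilado's (1.1) holds for its DH datum as well (the summit-side bookkeeping
form, via abc-iut-S2's bridge `cor312DH_ofInput_iff`). [claim: Mochizuki2012, status: disputed] [cite: DupuyHilado2025, §1 (1.1)] -/
theorem ThetaVolumeInput.cor312DH_ofInput_deepAtPlace (σ : PlaceSection F₀ K)
    (h3 : 3 * localDegree F₀ v₀.1 ≤ Module.finrank ℚ F₀) :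
    (DHData.ofInput (ThetaVolumeInput.deepAtPlace p v₀ l hl h5 N hN σ)).Cor312DH :=
  (DHData.cor312DH_ofInput_iff _).mpr (ThetaVolumeInput.cor312Of_deepAtPlace p v₀ l hl h5 N hN σ h3).1

end Witness

/-! ## The bad-mass sufficient condition, DH form, for every genuine input -/

namespace DHData

variable {F₀ : Type} [Field F₀] [NumberField F₀] {K : Type} [Field K] [NumberField K] [Algebra F₀ K]

/-- **Dupuy–Hilado's (1.1) for the datum of EVERY genuine input with bad mass `≤ 1/3` at each support prime**
(`Σ_{v|p, v∈𝕍^bad} n_v ≤ [F₀:ℚ]/3`): the summit-side form of abc-iut-c312-3's `cor312Of_of_badMass_le_third` through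
abc-iut-S2's bridge `cor312DH_ofInput_iff`. A theorem about OUR typed objects; no side taken on print's Cor. 3.12.
[claim: Mochizuki2012, status: disputed] [cite: DupuyHilado2025, §1 (1.1), §3.6] -/
theorem cor312DH_ofInput_of_badMass_le_third (I : ThetaVolumeInput F₀ K)
    (h : ∀ p ∈ I.supportPrimes,
      ∑ v : placesOver F₀ p, (I.X.S : Set (HeightOneSpectrum (𝓞 F₀))).indicator (weight F₀) v.1 ≤ 1 / 3) :
    (ofInput I).Cor312DH ∧ I.Cor312Of :=
  ⟨(cor312DH_ofInput_iff I).mpr (I.cor312Of_of_badMass_le_third h).1, (I.cor312Of_of_badMass_le_third h).2⟩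

end DHData

end Summit.ABC.IUTFork

end
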